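import Summits.QuantumFields.YangMills.Theorems.BalabanUVNodesN21ThresholdMixtureTStepChi
import Literature.MathematicalPhysics.QuantumFieldTheory.Balaban1983to89.Node00.TStepOfRecord
import Literature.MathematicalPhysics.QuantumFieldTheory.Balaban1983to89.T4DressedR

/-!
# N21 (NE7c), strategy s3 «alternative currency», file 15 — THE MIXTURE ROAD AT THE TWO OPERATIONS OF THE REPRESENTED TOWER:
# the 𝐓-step (†) COMMUTES with threshold mixtures at the value level; the typed 𝐑 (the (0.3) quotient) commutes on SPECTATOR integrals;
# displayed sharp factors separate from a threshold-dependent remainder BY SUPPORT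

Seat `pub-ymgap-dag-n21-e` (R141 (C) fan-out, node N21 = NE7c `T4IndicatorShell.ShellWeightBound`, strategy s3), g6.  Lane: `--kind proof
--supports stmt-QuantumFields-19912 --as helper` (K3‴ `SpineGivenEndpointR13`).  Count-neutral.

THE QUESTION (lens `LENS-nearmiss.md` Card 5, kill-test (K-ii), the cheapest falsifier of the mixture road): *is there a term remainder whose
DEFINITION — not merely its estimate — uses a threshold value?*  Files 13a∕13b (p491254∕p491885) and 14a∕14b (p495878∕p496646) answered it for the
record's (2.17) front factor and for the 𝐓-operation's (3.2)·(3.3) label weights: NO — each is the diagonal of a per-cube-threshold sharp product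
`∏ (pol c).fac 1[u_c < S_c]` with threshold-free tested variables, and its common-box average is the (η)-profiled product.  This file runs (K-ii)
against the two OPERATIONS which compose those factors into the represented tower of record (def-T `Node00.TStepOfRecord` ∕ `RepTowerOfRecord`,
def-R `Node00.RStepSlotOfRecord` ∕ `RStepRepr218`), both typed GENERIC IN THE SLOT:

* the value-level 𝐓-step (†) `Node00.texpASucc avg χk T w s′ V′ = h(V′)·∫ w(s′)(U,V′)·χ_k(init s′)(U)·T(init s′)(U) κ_{V′}(dU)` (kernel transport ×
  step weight × old front factor) is LINEAR in the weight, in the old front factor and in the slot; the averaging kernel `avgKernel avg V′` is a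
  Markov kernel.  Hence (§1, Fubini): for multipliers `θ` in any finite measure space, **the `θ`-integral of (†) run SHARP at `θ`-parametric
  (old front factor, step weight) IS (†) at the `θ`-integrated factors** — with separated multiplier blocks, (†) at (∫χ_k, ∫w), i.e. by 13b∕14b at
  the (η)-PROFILED front factor and label weights; the NEW front factor `χ_{k+1}(s′)(V′)`, which in print shares cubes (hence multipliers) with the (3.2)
  part of the weight ((3.2) p. 265 → (3.25) p. 270), is constant in the fine field and rides INSIDE the weight (`texpASucc_const_mul`).  (K-ii) PASSES through 𝐓.
* def-R's 𝐑 as a slot operation is FILE 7's `rstepOfSel`: new slot `TexpA(a′)·Σ_{a ↦ a′} ∫⌈_{fib a}(χ_a·TexpA_a) ∕ ∫⌈_{fib a}(χ_{a′}·TexpA_{a′})`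
  (`RStepRepr218` `rratio` ∕ `rstepOfSel`; assembled density `= B15.BasicStep.RopReal (rterm r) sel fib`, `holds_rstepOfSel`) — the (0.3) QUOTIENT of
  [Balaban1989LargeFieldI] p. 176, NONLINEAR in the slot: the remainder's definition reads the pinned `r.χ` (thresholds) in numerator AND
  denominator.  So (K-ii) FIRES at the value level there, AS TYPED.  (Print-side remark, lens §1 N18 (K11-i)(α): the operation of [B15] §1,
  pp. 193–194 ∕ (1.100) p. 201, is the LINEAR local integration with term-independent denominators; (0.3) is the Introduction's description,
  p. 177 L1–6.  Nothing here adjudicates print; the statements below are about the typed objects.)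
* It is NEUTRALISED ON SPECTATOR INTEGRALS (§2): for a test function `w` independent of every term's fibre bond set, `∫ w·ℝ(ρ_θ) = ∫ w·Σ_Z ρ_θ(Z)`
  for EVERY `θ` (tree: `T4DressedR.ropRealIn_eq_mul_of_fibreIndep` + `integral_ropRealIn_eq` — the real (0.4)-spectator; `lintegral_mul_rop03_of_indepOf`
  is its `ℝ≥0∞` form), which is LINEAR in the term vector, so `θ`-integrals pass through ℝ on such integrals (`integral_integral_mul_ropReal_eq`), and
  land on `∫ w·ℝ(∫ρ_θ dθ)` whenever the integrated pieces satisfy the provisos (`…_eq_integral_mul_ropReal`).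
* It is NEUTRALISED BY SUPPORT for the DISPLAYED sharp factors (§3): a remainder `R S v` that agrees with a threshold-free `R₀ v` wherever the displayed
  product `∏_{c∈A}(pol c).fac 1[u_c v < S_c]` is non-zero may replace it — pointwise, hence under the common-box average: 14a's `hXs`∕`hA` pair
  `commonBox_average_facWeight_eq` survives with the remainder threshold-free ONLY ON THE SUPPORT (`commonBox_average_facWeight_eq_of_support`).
* It BITES exactly at the small-field occurrences ON the fibre bond sets (`fibOfSeq`) inside the (0.3) denominators — the cubes of `Z′` are
  small-field cubes of the receiving term `Z″`, their characteristic functions are integrated over the fibre, so their multipliers enter the weight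
  through `∫⌈χ^{S}(…) ∕ ∫⌈χ^{S′}(…)`.  LOCATED INPUT (O-mix-4) «ℝ-DENOMINATOR THRESHOLD SENSITIVITY» (stated, not typed; NODE O ∕ def-R ∕ N20 species).
* §4 reads §1 at the letters OF RECORD (`G = SU(N)`, def-T's `tstepOfRecord`, front factors at print's pins `chiSeqOfRecord`): the T-step of record with
  `θ`-parametric STEP WEIGHTS integrates to the T-step at the integrated weights (`integral_tstepOfRecord_eq`).  The front-factor half of §1 at the
  record waits on the «thresholds as a letter» definition-lane twin located by dag-n21-d (bus l.16409) — not typed here.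

HONEST FRAMING.  NE7c is NOT PRINTED and NOT PROVED.  Kernel bookkeeping (three Fubini swaps, one pointwise case split) over def-T ∕ def-R ∕ b01 ∕
T4DressedR letters; the mixture (a convex combination of print's SHARP procedure over admissible threshold vectors) is design, NOT print verbatim;
(M1) for print's deterministic sharp procedure untouched; nothing of Bałaban's asserted; N21 NOT discharged; count-neutral; one finite four-torus
programme at fixed `ε`; NOT continuum ∕ ℝ⁴ ∕ OS ∕ mass gap ∕ Clay.

CITATION HEADER (lean-in-tree rule 2026-08-18).  BY NAME: def-T `Node00.texpASucc` ∕ `texpASucc_apply` ∕ `tstepOfRecord` ∕ `StepWeightsOfRecord`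
([Balaban1988Convergent] (3.1) p. 264, (3.24)–(3.25) p. 270, typed there with locators); b01 `B15.BasicStep.RopReal` ∕ `fibreIntegral` ∕ `normTerm` and
`T4DressedR.FibreIndep` ∕ `RopRealIn` ∕ `integral_ropRealIn_eq` ∕ `ropRealIn_eq_mul_of_fibreIndep` ([Balaban1989LargeFieldI] (0.3)–(0.4) p. 176, (1.102) p. 201);
`T4AveragingDisintegration.avgKernel` ∕ `avgDensity`; 14a `commonBox_average_facWeight_eq`; `T4IndicatorShell.smallInd`; `T4LipschitzCutoff.linProfile`;
`T4LipschitzLedger.Pol`.  Context only (SHAPE): [Balaban1989LargeFieldI] (0.3) p. 176 — *"(ℝρ)(V) = Σ_Z ρ(Z″,V) ∫dV⌈_{Z′}ρ(Z,V) ∕ ∫dV⌈_{Z′}ρ(Z″,V)"*;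
[Balaban1988Convergent] (3.1) p. 264 — *"(Tρ_k)(V_{k+1}) = ∫dV_k δ(V̄_kV_{k+1}⁻¹) ρ_k(V_k)"*.

WHAT IS PROVED ([folklore] unless cited).  §1 `texpASucc_const_mul` · ★ `integral_texpASucc_eq` · ★★ `integral_texpASucc_prod_eq` ·
`integral_chi_mul_texpASucc_prod_eq`; §2 `integral_mul_ropReal_eq_of_fibreIndep` · ★ `integral_integral_mul_ropReal_eq` ·
`integral_integral_mul_ropReal_eq_integral_mul_ropReal`; §3 `prod_fac_smallInd_mul_eq_of_support` · ★ `commonBox_average_facWeight_eq_of_support`;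
§4 ★ `integral_tstepOfRecord_eq`.
-/

set_option autoImplicit false

noncomputable section

open MeasureTheory Set
open scoped BigOperators ENNReal

namespace Summit.QuantumFields.YangMills.Theorems.N21ThresholdMixtureTowerOps

open Literature.MathematicalPhysics.QuantumFieldTheory.Balaban1983to89
open Literature.MathematicalPhysics.QuantumFieldTheory.Balaban1983to89.B14.Eq218Concrete
open Literature.MathematicalPhysics.QuantumFieldTheory.Balaban1983to89.T4AveragingDisintegration (avgKernel avgDensity)
open Literature.MathematicalPhysics.QuantumFieldTheory.Balaban1983to89.Node00
open Literature.MathematicalPhysics.QuantumFieldTheory.Balaban1983to89.B15.BasicStep (fibreIntegral normTerm RopReal)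
open Literature.MathematicalPhysics.QuantumFieldTheory.Balaban1983to89.T4DressedR (FibreIndep RopRealIn integral_ropRealIn_eq
  ropRealIn_eq_mul_of_fibreIndep)
open Literature.MathematicalPhysics.QuantumFieldTheory.Balaban1983to89.T4IndicatorShell
open Literature.MathematicalPhysics.QuantumFieldTheory.Balaban1983to89.T4LipschitzCutoff
open Literature.MathematicalPhysics.QuantumFieldTheory.Balaban1983to89.T4LipschitzLedger
open Summit.QuantumFields.YangMills.Theorems.N21ThresholdMixtureTStepChi (prod_fac_smallInd_mem_unitInterval commonBox_average_facWeight_eq)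

/-! ## §1 The value-level 𝐓-step (†) COMMUTES with threshold mixtures (def-T §1 generic level) -/

section TStep

variable {P : Params} {G : Type*} [GaugeGroup G] [MeasurableSpace G] [HaarData G] [StandardBorelSpace G]
variable {α : Type*} {D : ℕ → Set (Set α)} {k : ℕ}

/-- A factor constant in the fine field `U` rides INSIDE the step weight of (†): `c(s′)(V′)·(†)[χk, T, w](s′)(V′) = (†)[χk, T, c·w](s′)(V′)`
(the kernel transport is linear in the integrand).  This is where the NEW front factor `χ_{k+1}(s′)(V′)` — which in print shares cubes, hence
multipliers, with the (3.2) part of the weight — lives on the mixture road. [cite: Balaban1988Convergent, (3.1) p.264 (bookkeeping)] -/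
theorem texpASucc_const_mul (avg : GaugeField P k G → GaugeField P (k + 1) G) (χk T : Seq D k → Density P k G)
    (w : Seq D (k + 1) → GaugeField P k G → GaugeField P (k + 1) G → ℝ)
    (c : Seq D (k + 1) → GaugeField P (k + 1) G → ℝ) (s' : Seq D (k + 1)) (V' : GaugeField P (k + 1) G) :
    c s' V' * texpASucc avg χk T w s' V' = texpASucc avg χk T (fun s U V => c s V * w s U V) s' V' := by
  rw [texpASucc_apply, texpASucc_apply, mul_left_comm, ← integral_const_mul]
  congr 1
  exact integral_congr_ae (ae_of_all _ fun U => by beta_reduce; ring)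

variable {Θ : Type*} [MeasurableSpace Θ]

/-- ★ **THE `θ`-INTEGRAL OF (†) RUN SHARP AT `θ`-PARAMETRIC FACTORS** (joint cofactor form).  Multipliers `θ` in a finite measure space `(Θ, μΘ)`,
a `θ`-parametric old front factor `χk_θ` and step weight `w_θ` whose product is jointly measurable and bounded in `(θ, U)`, a slot `T` integrable along
the averaging fibre at `V′`: `∫_Θ (†)[χk_θ, T, w_θ](s′)(V′) dμΘ = h(V′)·∫_U (∫_Θ w_θ(s′)(U,V′)·χk_θ(init s′)(U) dμΘ)·T(init s′)(U) κ_{V′}(dU)` — one Fubini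
swap over `μΘ ⊗ κ_{V′}` (`avgKernel avg V′` is a Markov kernel). [folklore] -/
theorem integral_texpASucc_eq (μΘ : Measure Θ) [IsFiniteMeasure μΘ] (avg : GaugeField P k G → GaugeField P (k + 1) G)
    (χk : Θ → Seq D k → Density P k G) (T : Seq D k → Density P k G)
    (w : Θ → Seq D (k + 1) → GaugeField P k G → GaugeField P (k + 1) G → ℝ) (s' : Seq D (k + 1))
    (V' : GaugeField P (k + 1) G)
    (hm : Measurable fun p : Θ × GaugeField P k G => w p.1 s' p.2 V' * χk p.1 s'.init p.2)
    {C : ℝ} (hC : ∀ θ U, |w θ s' U V' * χk θ s'.init U| ≤ C)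
    (hT : Integrable (T s'.init) (avgKernel avg V')) :
    ∫ θ, texpASucc avg (χk θ) T (w θ) s' V' ∂μΘ
      = (avgDensity avg V' : ℝ) *
          ∫ U, (∫ θ, w θ s' U V' * χk θ s'.init U ∂μΘ) * T s'.init U ∂(avgKernel avg V') := by
  simp only [texpASucc_apply]
  rw [integral_const_mul]
  congr 1
  have hT2 : Integrable (fun p : Θ × GaugeField P k G => T s'.init p.2) (μΘ.prod (avgKernel avg V')) :=
    hT.comp_snd μΘ
  have hF : Integrable (Function.uncurry fun (θ : Θ) (U : GaugeField P k G) =>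
      w θ s' U V' * (χk θ s'.init U * T s'.init U)) (μΘ.prod (avgKernel avg V')) := by
    refine (hT2.bdd_mul (c := C) hm.aestronglyMeasurable (ae_of_all _ fun p => ?_)).congr
      (ae_of_all _ fun p => ?_)
    · rw [Real.norm_eq_abs]
      exact hC p.1 p.2
    · simp only [Function.uncurry]
      ring
  rw [integral_integral_swap hF]
  refine integral_congr_ae (ae_of_all _ fun U => ?_)
  beta_reduce
  rw [← integral_mul_const]
  exact integral_congr_ae (ae_of_all _ fun θ => by ring)

/-- ★★ **SEPARATED MULTIPLIER BLOCKS: (η)'s PROFILED 𝐓-STEP IS THE BOX-INTEGRAL OF PRINT'S SHARP 𝐓-STEP** (value level).  With `μΘ = μ₁ ⊗ μ₂`, the old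
front factor reading block 1 and the step weight reading block 2 (both jointly measurable, bounded by `1` in absolute value — def-T's `absW_le` ∕
`|χ| ≤ 1` shape), and a slot integrable along the fibre at `V′`:
`∫ (†)[χk_{θ₁}, T, w_{θ₂}](s′)(V′) d(μ₁ ⊗ μ₂) = (†)[∫χk dμ₁, T, ∫w dμ₂](s′)(V′)`.
At the record 13b's `commonBox_average_chi218_record_eq_profile` and 14b's `commonBox_average_tStepLabel_eq_profile` identify the two integrated factors
(after normalisation) with the (η)-profiled front factor and label weights. [folklore] -/
theorem integral_texpASucc_prod_eq {Θ₁ Θ₂ : Type*} [MeasurableSpace Θ₁] [MeasurableSpace Θ₂] (μ₁ : Measure Θ₁) (μ₂ : Measure Θ₂)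
    [IsFiniteMeasure μ₁] [IsFiniteMeasure μ₂] (avg : GaugeField P k G → GaugeField P (k + 1) G)
    (χk : Θ₁ → Seq D k → Density P k G) (T : Seq D k → Density P k G)
    (w : Θ₂ → Seq D (k + 1) → GaugeField P k G → GaugeField P (k + 1) G → ℝ) (s' : Seq D (k + 1))
    (V' : GaugeField P (k + 1) G)
    (hχm : Measurable fun p : Θ₁ × GaugeField P k G => χk p.1 s'.init p.2)
    (hwm : Measurable fun p : Θ₂ × GaugeField P k G => w p.1 s' p.2 V')
    (hχb : ∀ θ₁ U, |χk θ₁ s'.init U| ≤ 1) (hwb : ∀ θ₂ U, |w θ₂ s' U V'| ≤ 1)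
    (hT : Integrable (T s'.init) (avgKernel avg V')) :
    ∫ θ, texpASucc avg (χk θ.1) T (w θ.2) s' V' ∂(μ₁.prod μ₂)
      = texpASucc avg (fun s U => ∫ θ₁, χk θ₁ s U ∂μ₁) T (fun s U V => ∫ θ₂, w θ₂ s U V ∂μ₂) s' V' := by
  have hm : Measurable fun p : (Θ₁ × Θ₂) × GaugeField P k G => w p.1.2 s' p.2 V' * χk p.1.1 s'.init p.2 :=
    (hwm.comp (measurable_fst.snd.prodMk measurable_snd)).mul (hχm.comp (measurable_fst.fst.prodMk measurable_snd))
  have hC : ∀ (θ : Θ₁ × Θ₂) (U : GaugeField P k G), |w θ.2 s' U V' * χk θ.1 s'.init U| ≤ 1 := by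
    intro θ U
    rw [abs_mul]
    calc |w θ.2 s' U V'| * |χk θ.1 s'.init U| ≤ 1 * 1 :=
          mul_le_mul (hwb _ _) (hχb _ _) (abs_nonneg _) zero_le_one
      _ = 1 := one_mul _
  rw [integral_texpASucc_eq (μ₁.prod μ₂) avg (fun θ => χk θ.1) T (fun θ => w θ.2) s' V' hm hC hT, texpASucc_apply]
  congr 1
  refine integral_congr_ae (ae_of_all _ fun U => ?_)
  beta_reduce
  have hswap : ∫ θ : Θ₁ × Θ₂, w θ.2 s' U V' * χk θ.1 s'.init U ∂(μ₁.prod μ₂)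
      = ∫ θ : Θ₁ × Θ₂, χk θ.1 s'.init U * w θ.2 s' U V' ∂(μ₁.prod μ₂) :=
    integral_congr_ae (ae_of_all _ fun θ => mul_comm _ _)
  have hpm := integral_prod_mul (μ := μ₁) (ν := μ₂) (fun θ₁ => χk θ₁ s'.init U) (fun θ₂ => w θ₂ s' U V')
  beta_reduce at hpm
  rw [hswap, hpm]
  ring

/-- **THE NEW FRONT FACTOR SHARES THE WEIGHT's BLOCK.**  With the level-`(k+1)` front factor `χk1_{θ₂}(s′)(V′)` reading the SAME multiplier block as the
step weight (in print its cubes are among the (3.2) cubes), the old front factor reading block 1: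
`∫ χk1_{θ₂}(s′)(V′)·(†)[χk_{θ₁}, T, w_{θ₂}](s′)(V′) d(μ₁ ⊗ μ₂) = (†)[∫χk dμ₁, T, ∫(χk1·w) dμ₂](s′)(V′)` — the averaged new front factor does NOT factor
out of the averaged weight (same multipliers); it is absorbed into it (`texpASucc_const_mul`). [folklore] -/
theorem integral_chi_mul_texpASucc_prod_eq {Θ₁ Θ₂ : Type*} [MeasurableSpace Θ₁] [MeasurableSpace Θ₂] (μ₁ : Measure Θ₁)
    (μ₂ : Measure Θ₂) [IsFiniteMeasure μ₁] [IsFiniteMeasure μ₂] (avg : GaugeField P k G → GaugeField P (k + 1) G)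
    (χk : Θ₁ → Seq D k → Density P k G) (χk1 : Θ₂ → Seq D (k + 1) → Density P (k + 1) G) (T : Seq D k → Density P k G)
    (w : Θ₂ → Seq D (k + 1) → GaugeField P k G → GaugeField P (k + 1) G → ℝ) (s' : Seq D (k + 1))
    (V' : GaugeField P (k + 1) G)
    (hχm : Measurable fun p : Θ₁ × GaugeField P k G => χk p.1 s'.init p.2)
    (hχ1m : Measurable fun θ₂ : Θ₂ => χk1 θ₂ s' V')
    (hwm : Measurable fun p : Θ₂ × GaugeField P k G => w p.1 s' p.2 V')
    (hχb : ∀ θ₁ U, |χk θ₁ s'.init U| ≤ 1) (hχ1b : ∀ θ₂, |χk1 θ₂ s' V'| ≤ 1) (hwb : ∀ θ₂ U, |w θ₂ s' U V'| ≤ 1)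
    (hT : Integrable (T s'.init) (avgKernel avg V')) :
    ∫ θ, χk1 θ.2 s' V' * texpASucc avg (χk θ.1) T (w θ.2) s' V' ∂(μ₁.prod μ₂)
      = texpASucc avg (fun s U => ∫ θ₁, χk θ₁ s U ∂μ₁) T
          (fun s U V => ∫ θ₂, χk1 θ₂ s V * w θ₂ s U V ∂μ₂) s' V' := by
  have hpt : ∀ θ : Θ₁ × Θ₂, χk1 θ.2 s' V' * texpASucc avg (χk θ.1) T (w θ.2) s' V'
      = texpASucc avg (χk θ.1) T (fun s U V => χk1 θ.2 s V * w θ.2 s U V) s' V' :=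
    fun θ => texpASucc_const_mul avg (χk θ.1) T (w θ.2) (χk1 θ.2) s' V'
  simp_rw [hpt]
  have hwm' : Measurable fun p : Θ₂ × GaugeField P k G => χk1 p.1 s' V' * w p.1 s' p.2 V' :=
    (hχ1m.comp measurable_fst).mul hwm
  have hwb' : ∀ (θ₂ : Θ₂) (U : GaugeField P k G), |χk1 θ₂ s' V' * w θ₂ s' U V'| ≤ 1 := by
    intro θ₂ U
    rw [abs_mul]
    calc |χk1 θ₂ s' V'| * |w θ₂ s' U V'| ≤ 1 * 1 := mul_le_mul (hχ1b _) (hwb _ _) (abs_nonneg _) zero_le_one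
      _ = 1 := one_mul _
  exact integral_texpASucc_prod_eq μ₁ μ₂ avg χk T (fun θ₂ s U V => χk1 θ₂ s V * w θ₂ s U V) s' V' hχm hwm' hχb hwb' hT

end TStep

/-! ## §2 The typed 𝐑 (the (0.3) quotient `RopReal`) commutes with threshold mixtures ON SPECTATOR INTEGRALS (b01 ∕ T4DressedR generic level) -/

section RStep

variable {P : Params} {j : ℕ} {G : Type*} [GaugeGroup G] [MeasurableSpace G] [HaarData G]
variable [DecidableEq (PBond P j)]

/-- **THE REAL (0.4)-SPECTATOR IDENTITY** (two tree lemmas composed: `T4DressedR.ropRealIn_eq_mul_of_fibreIndep` + `integral_ropRealIn_eq`): for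
measurable nonnegative uniformly bounded pieces with nowhere-vanishing denominators and a measurable bounded nonnegative test function `w` independent
of EVERY term's fibre bond set, `∫ w·ℝ(ρ) = ∫ (Σ_Z ρ(Z))·w` — on spectator integrals the quotient ℝ is invisible, hence LINEAR in the term vector.
[cite: Balaban1989LargeFieldI, (0.4) p.176, (1.102) p.201] -/
theorem integral_mul_ropReal_eq_of_fibreIndep {R : Type*} [Fintype R] (piece : R → Density P j G) (pp : R → R)
    (fib : R → Finset (PBond P j)) (w : Density P j G)
    (hm : ∀ Z, Measurable (piece Z)) (h0 : ∀ Z V, 0 ≤ piece Z V) {C : ℝ} (hC : ∀ Z V, piece Z V ≤ C)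
    (hden : ∀ Z V, fibreIntegral (fib Z) (piece (pp Z)) V ≠ 0)
    (hwm : Measurable w) (hwI : ∀ Z, FibreIndep (fib Z) w) (hw0 : ∀ V, 0 ≤ w V) {M : ℝ} (hwM : ∀ V, w V ≤ M) :
    ∫ V, w V * RopReal piece pp fib V ∂(fieldMeasure P j G) = ∫ V, (∑ Z, piece Z V) * w V ∂(fieldMeasure P j G) := by
  have h := integral_ropRealIn_eq piece pp fib w hm h0 hC hden hwm hw0 hwM
  rw [ropRealIn_eq_mul_of_fibreIndep piece pp fib w hm hwI hw0] at h
  exact h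

variable {Θ : Type*} [MeasurableSpace Θ]

/-- ★ **ON SPECTATOR INTEGRALS ℝ COMMUTES WITH THE MIXTURE.**  A `θ`-parametric term family `piece_θ` (multipliers in a finite measure space `(Θ, μΘ)`),
satisfying the undressed provisos at every `θ` with a UNIFORM bound, jointly measurable in `(θ, V)`, and a spectator `w` as above:
`∫_Θ (∫ w·ℝ(piece_θ) dV) dμΘ = ∫ w·(Σ_Z ∫_Θ piece_θ(Z) dμΘ) dV` — the mixture of the spectator integrals of the SHARP R-stepped terms is the spectator
integral of the integrated term vector (one Fubini swap on `μΘ ⊗ dV`). [folklore] -/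
theorem integral_integral_mul_ropReal_eq (μΘ : Measure Θ) [IsFiniteMeasure μΘ] {R : Type*} [Fintype R]
    (piece : Θ → R → Density P j G) (pp : R → R) (fib : R → Finset (PBond P j)) (w : Density P j G)
    (hm : ∀ Z, Measurable fun p : Θ × GaugeField P j G => piece p.1 Z p.2) (h0 : ∀ θ Z V, 0 ≤ piece θ Z V) {C : ℝ}
    (hC : ∀ θ Z V, piece θ Z V ≤ C) (hden : ∀ θ Z V, fibreIntegral (fib Z) (piece θ (pp Z)) V ≠ 0)
    (hwm : Measurable w) (hwI : ∀ Z, FibreIndep (fib Z) w) (hw0 : ∀ V, 0 ≤ w V) {M : ℝ} (hwM : ∀ V, w V ≤ M) :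
    ∫ θ, (∫ V, w V * RopReal (piece θ) pp fib V ∂(fieldMeasure P j G)) ∂μΘ
      = ∫ V, w V * ∑ Z, (∫ θ, piece θ Z V ∂μΘ) ∂(fieldMeasure P j G) := by
  have hmθ : ∀ θ Z, Measurable (piece θ Z) := fun θ Z => (hm Z).comp (measurable_const.prodMk measurable_id)
  have hθ : ∀ θ, ∫ V, w V * RopReal (piece θ) pp fib V ∂(fieldMeasure P j G)
      = ∫ V, (∑ Z, piece θ Z V) * w V ∂(fieldMeasure P j G) :=
    fun θ => integral_mul_ropReal_eq_of_fibreIndep (piece θ) pp fib w (hmθ θ) (h0 θ) (hC θ) (hden θ) hwm hwI hw0 hwM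
  simp_rw [hθ]
  -- Fubini on `μΘ ⊗ dV` for the LINEAR right-hand side (a bounded measurable integrand on a finite product measure)
  have hpw : ∀ (θ : Θ) (V : GaugeField P j G), ‖(∑ Z, piece θ Z V) * w V‖ ≤ (∑ _Z : R, C) * M := by
    intro θ V
    rw [Real.norm_eq_abs, abs_mul, abs_of_nonneg (Finset.sum_nonneg fun Z _ => h0 θ Z V), abs_of_nonneg (hw0 V)]
    exact mul_le_mul (Finset.sum_le_sum fun Z _ => hC θ Z V) (hwM V) (hw0 V)
      (Finset.sum_nonneg fun Z _ => le_trans (h0 θ Z V) (hC θ Z V))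
  have hFm : Measurable fun p : Θ × GaugeField P j G => (∑ Z, piece p.1 Z p.2) * w p.2 := by
    refine Measurable.mul ?_ (hwm.comp measurable_snd)
    exact Finset.measurable_sum _ fun Z _ => hm Z
  have hF : Integrable (Function.uncurry fun (θ : Θ) (V : GaugeField P j G) => (∑ Z, piece θ Z V) * w V)
      (μΘ.prod (fieldMeasure P j G)) :=
    Integrable.of_bound hFm.aestronglyMeasurable ((∑ _Z : R, C) * M) (ae_of_all _ fun p => hpw p.1 p.2)
  rw [integral_integral_swap hF]
  refine integral_congr_ae (ae_of_all _ fun V => ?_)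
  have hiZ : ∀ Z, Integrable (fun θ => piece θ Z V) μΘ := fun Z =>
    Integrable.of_bound ((hm Z).comp (measurable_id.prodMk measurable_const)).aestronglyMeasurable C
      (ae_of_all _ fun θ => by
        rw [Real.norm_eq_abs, abs_of_nonneg (h0 θ Z V)]
        exact hC θ Z V)
  show ∫ θ, (∑ Z, piece θ Z V) * w V ∂μΘ = w V * ∑ Z, ∫ θ, piece θ Z V ∂μΘ
  rw [integral_mul_const, integral_finsetSum _ fun Z _ => hiZ Z, mul_comm]

/-- **… AND LANDS ON ℝ OF THE INTEGRATED TERM VECTOR** whenever the integrated pieces `Z ↦ ∫_Θ piece_θ(Z) dμΘ` satisfy the (0.4) provisos themselves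
(measurable, nonnegative, bounded — automatic — and nowhere-vanishing denominators — DISPLAYED as `hden'`):
`∫_Θ (∫ w·ℝ(piece_θ) dV) dμΘ = ∫ w·ℝ(∫_Θ piece_θ dμΘ) dV`.  On spectator integrals «ℝ of the average = average of ℝ», although pointwise the
quotient ℝ is not linear (the tree's witness of that species: `T4DressedR.naive_dressing_not_preserving`). [folklore] -/
theorem integral_integral_mul_ropReal_eq_integral_mul_ropReal (μΘ : Measure Θ) [IsFiniteMeasure μΘ] {R : Type*} [Fintype R]
    (piece : Θ → R → Density P j G) (pp : R → R) (fib : R → Finset (PBond P j)) (w : Density P j G)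
    (hm : ∀ Z, Measurable fun p : Θ × GaugeField P j G => piece p.1 Z p.2) (h0 : ∀ θ Z V, 0 ≤ piece θ Z V) {C : ℝ}
    (hC : ∀ θ Z V, piece θ Z V ≤ C) (hden : ∀ θ Z V, fibreIntegral (fib Z) (piece θ (pp Z)) V ≠ 0)
    (hden' : ∀ Z V, fibreIntegral (fib Z) (fun U => ∫ θ, piece θ (pp Z) U ∂μΘ) V ≠ 0)
    (hwm : Measurable w) (hwI : ∀ Z, FibreIndep (fib Z) w) (hw0 : ∀ V, 0 ≤ w V) {M : ℝ} (hwM : ∀ V, w V ≤ M) :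
    ∫ θ, (∫ V, w V * RopReal (piece θ) pp fib V ∂(fieldMeasure P j G)) ∂μΘ
      = ∫ V, w V * RopReal (fun Z U => ∫ θ, piece θ Z U ∂μΘ) pp fib V ∂(fieldMeasure P j G) := by
  rw [integral_integral_mul_ropReal_eq μΘ piece pp fib w hm h0 hC hden hwm hwI hw0 hwM]
  -- the integrated pieces satisfy the undressed provisos with the bound `μΘ.real univ * C`
  have hm' : ∀ Z, Measurable fun U : GaugeField P j G => ∫ θ, piece θ Z U ∂μΘ := fun Z =>
    ((hm Z).stronglyMeasurable.integral_prod_left' (μ := μΘ)).measurable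
  have h0' : ∀ Z (V : GaugeField P j G), 0 ≤ ∫ θ, piece θ Z V ∂μΘ := fun Z V => integral_nonneg fun θ => h0 θ Z V
  have hC' : ∀ Z (V : GaugeField P j G), ∫ θ, piece θ Z V ∂μΘ ≤ μΘ.real Set.univ * C := by
    intro Z V
    have h := integral_mono_of_nonneg (μ := μΘ) (f := fun θ => piece θ Z V) (g := fun _ => C)
      (ae_of_all _ fun θ => h0 θ Z V) (integrable_const C) (ae_of_all _ fun θ => hC θ Z V)
    rw [integral_const, smul_eq_mul] at h
    exact h
  rw [integral_mul_ropReal_eq_of_fibreIndep (fun Z U => ∫ θ, piece θ Z U ∂μΘ) pp fib w hm' h0' hC' hden' hwm hwI hw0 hwM]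
  refine integral_congr_ae (ae_of_all _ fun V => ?_)
  exact mul_comm _ _

end RStep

/-! ## §3 Displayed sharp factors separate from a threshold-dependent remainder BY SUPPORT (13a ∕ 14a letters) -/

section Support

variable {ι : Type*} {Y : Type*} [MeasurableSpace Y]

omit [MeasurableSpace Y] in
/-- **POINTWISE.**  If the remainder `R S v` agrees with a threshold-free `R₀ v` wherever the displayed mixed-polarity sharp product
`∏_{c∈A}(pol c).fac 1[u_c v < S_c]` does not vanish, then `(∏ …)·R S v = (∏ …)·R₀ v` — off the support both sides are `0`.  (On the mixture road:
characteristic functions of displayed OFF-FIBRE cubes sitting inside an (0.3) denominator equal `1` on the support of the displayed product.) [folklore] -/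
theorem prod_fac_smallInd_mul_eq_of_support (A : Finset ι) (pol : ι → Pol) (u : ι → Y → ℝ) (R : (ι → ℝ) → Y → ℝ) (R₀ : Y → ℝ)
    (hR : ∀ S v, (∏ c ∈ A, (pol c).fac (smallInd (u c v) (S c))) ≠ 0 → R S v = R₀ v) (S : ι → ℝ) (v : Y) :
    (∏ c ∈ A, (pol c).fac (smallInd (u c v) (S c))) * R S v = (∏ c ∈ A, (pol c).fac (smallInd (u c v) (S c))) * R₀ v := by
  by_cases h : (∏ c ∈ A, (pol c).fac (smallInd (u c v) (S c))) = 0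
  · rw [h, zero_mul, zero_mul]
  · rw [hR S v h]

variable [Fintype ι] [DecidableEq ι]

/-- ★ **THE `hXs` ∕ `hA` PAIR SURVIVES A REMAINDER THAT IS THRESHOLD-FREE ONLY ON THE SUPPORT.**  14a's `commonBox_average_facWeight_eq` with the
remainder `R S v` allowed to depend on the threshold vector `S` OFF the support of the displayed product: for an s-finite field law `μ`, an integrable
threshold-free `R₀` with `R S v = R₀ v` on the support, windows `[(1 − κ_c)θ_c, θ_c]` (`0 < κ_c`, `0 < θ_c`),
`(∏_c κ_cθ_c)⁻¹ · ∫_S ∫_v (∏_{c∈A}(pol c).fac 1[u_c v < S_c])·R S v dμ dS = ∫_v (∏_{c∈A}(pol c).fac (linProfile κ_c (u_c v ∕ θ_c)))·R₀ v dμ`. [folklore] -/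
theorem commonBox_average_facWeight_eq_of_support (μ : Measure Y) [SFinite μ] (A : Finset ι) (pol : ι → Pol) (κ θ : ι → ℝ)
    {u : ι → Y → ℝ} (hu : ∀ c ∈ A, Measurable (u c)) (R : (ι → ℝ) → Y → ℝ) {R₀ : Y → ℝ} (hR₀ : Integrable R₀ μ)
    (hR : ∀ S v, (∏ c ∈ A, (pol c).fac (smallInd (u c v) (S c))) ≠ 0 → R S v = R₀ v)
    (hκ : ∀ c, 0 < κ c) (hθ : ∀ c, 0 < θ c) :
    (∏ c, (κ c * θ c))⁻¹ *
        ∫ S, (∫ v, (∏ c ∈ A, (pol c).fac (smallInd (u c v) (S c))) * R S v ∂μ)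
          ∂(Measure.pi fun c => volume.restrict (Icc ((1 - κ c) * θ c) (θ c)))
      = ∫ v, (∏ c ∈ A, (pol c).fac (linProfile (κ c) (u c v / θ c))) * R₀ v ∂μ := by
  have hpt : ∀ (S : ι → ℝ) (v : Y), (∏ c ∈ A, (pol c).fac (smallInd (u c v) (S c))) * R S v
      = (∏ c ∈ A, (pol c).fac (smallInd (u c v) (S c))) * R₀ v :=
    fun S v => prod_fac_smallInd_mul_eq_of_support A pol u R R₀ hR S v
  simp_rw [hpt]
  exact commonBox_average_facWeight_eq μ A pol κ θ hu hR₀ hκ hθ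

end Support

/-! ## §4 OF RECORD (`G = SU(N)`): def-T's T-step of record with `θ`-parametric step weights -/

section Record

open T4Continuum

variable (F : T4Family) (N : ℕ) [NeZero N]
variable {Θ : Type*} [MeasurableSpace Θ]

/-- ★ **THE T-STEP OF RECORD WITH `θ`-PARAMETRIC STEP WEIGHTS INTEGRATES TO THE T-STEP AT THE INTEGRATED WEIGHTS** (value level; front factors at
print's pins `chiSeqOfRecord`).  For a family `w_θ : StepWeightsOfRecord F N ν M` jointly measurable in `(θ, U)` at `(p, g, k, s′, V′)` with
`|w_θ| ≤ 1` (def-T's `absW_le` shape), and the level-`k` piece `χ_k(init s′)·T(init s′)` integrable along the averaging fibre at `V′`: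
`∫_Θ tstepOfRecord F N ν M w_θ p g k T s′ V′ dμΘ = tstepOfRecord F N ν M w̄ p g k T s′ V′` with `w̄ p g k s′ U V′ := ∫_Θ w_θ p g k s′ U V′ dμΘ`.
(The step-weight half of §1 at the letters of record — 14b's `commonBox_average_tStepWeight_eq_profile` identifies the normalised `w̄` of the
(3.2)·(3.3) part with the (η)-profiled label weight; the front-factor half waits on the «thresholds as a letter» twin.)
[cite: Balaban1988Convergent, (3.1) p.264, (3.24)–(3.25) p.270 (bookkeeping)] -/
theorem integral_tstepOfRecord_eq (μΘ : Measure Θ) [IsFiniteMeasure μΘ] (ν : Stage7Numerics) (M : ℕ)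
    (w : Θ → StepWeightsOfRecord F N ν M) (p : B12.RunParams) (g : ℕ → ℝ) (k : ℕ)
    (T : SeqOfRecord F ν M g p.K k → Density (F.P p.K) k (SU N)) (s' : SeqOfRecord F ν M g p.K (k + 1))
    (V' : GaugeField (F.P p.K) (k + 1) (SU N))
    (hwm : Measurable fun q : Θ × GaugeField (F.P p.K) k (SU N) => w q.1 p g k s' q.2 V')
    (hwb : ∀ θ U, |w θ p g k s' U V'| ≤ 1)
    (hT : Integrable (fun U => chiSeqOfRecord F N ν M g p.K k s'.init U * T s'.init U)
      (avgKernel (avOfRecord F N p.K k).avg V')) :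
    ∫ θ, tstepOfRecord F N ν M (w θ) p g k T s' V' ∂μΘ
      = tstepOfRecord F N ν M (fun p g k s U V => ∫ θ, w θ p g k s U V ∂μΘ) p g k T s' V' := by
  -- (†) with the old front factor absorbed into the slot: `(†)[χ, T, w] = (†)[1, χ·T, w]`
  have hre : ∀ w' : StepWeightsOfRecord F N ν M, tstepOfRecord F N ν M w' p g k T s' V'
      = texpASucc (avOfRecord F N p.K k).avg (fun _ _ => (1 : ℝ))
          (fun s U => chiSeqOfRecord F N ν M g p.K k s U * T s U) (w' p g k) s' V' := by
    intro w'
    rw [tstepOfRecord, texpASucc_apply, texpASucc_apply]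
    congr 1
    exact integral_congr_ae (ae_of_all _ fun U => by beta_reduce; ring)
  simp_rw [hre]
  have hm : Measurable fun q : Θ × GaugeField (F.P p.K) k (SU N) =>
      w q.1 p g k s' q.2 V' * (fun (_ : Θ) (_ : SeqOfRecord F ν M g p.K k) (_ : GaugeField (F.P p.K) k (SU N)) => (1 : ℝ))
        q.1 s'.init q.2 := by
    simpa using hwm
  have hC : ∀ (θ : Θ) (U : GaugeField (F.P p.K) k (SU N)),
      |w θ p g k s' U V' * (fun (_ : Θ) (_ : SeqOfRecord F ν M g p.K k) (_ : GaugeField (F.P p.K) k (SU N)) => (1 : ℝ))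
        θ s'.init U| ≤ 1 := fun θ U => by simpa using hwb θ U
  rw [integral_texpASucc_eq μΘ (avOfRecord F N p.K k).avg (fun _ _ _ => (1 : ℝ)) _ (fun θ => w θ p g k) s' V' hm hC hT,
    texpASucc_apply]
  congr 1
  refine integral_congr_ae (ae_of_all _ fun U => ?_)
  simp only [mul_one, one_mul]

end Record

end Summit.QuantumFields.YangMills.Theorems.N21ThresholdMixtureTowerOps

end
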